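import Summits.QuantumFields.BalabanUV.T4Continuum.Spine.NE1p.DressedSuppliedDepthTwoWitness

/-!
# T⁴ programme, spine estimate NE1′ (node O3b/H2) — THE ABSORBED COUNT AT DEPTH TWO, PART 2 (the END and the GENUINE records): on PART 1's
# datum the seams hold with EQUALITY, END-B fires at the cell's integer `(Lb:ℝ) = L = 21` with ONE K-free scalar set, and from cutoff `2` on
# S5e's absorbed count `(v·mB)·Λ^(j_b−j₀)` is ATTAINED at BOTH depths `j_b − j₀ = 1` AND `2`; the second absorbed layer is charged and costs
# layer one times the located product `Λ·ρ₁·τ = e³∕21` (crew row W77 ∕ DAG N29zzzzh of `t4/formal/NE1p/LEAVES.md`, BOOKED typer gen 8 R-T140 l.23158; INTENT HOME/CLAIMS.log l.22794, STAGED l.23086)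

Cell `pub-balaban`, sub-cell `t4`, BINDER-OWNERS row NE1′, crew `b2b-balaban-t4-ne1p-formalise-*`, seat `leaf-02` (gen 16).  ADDITIVE — imports
PART 1 `Spine/NE1p/DressedSuppliedDepthTwoWitness` ONLY (→ W8 `DressedSuppliedWitness`: `rW`∕`tW`∕`hL21`∕`hloc21`∕`hρ'21`∕`stepProd_rW`; rows S3
`bookingLeavesCell`∕`dressedStability_of_cell`∕`prod_cell`, S3i `count_of_anchoring_cell`∕`positionalCount_of_anchoring_cell`, S5e
`hbirth_of_rstep_cell`∕`count_absorbs_of_anchoring`, S5b `fanout`∕`absorbAmplitude`, S4 `Anchoring.positionalCount_of_anchoring`, W14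
`coarsen_coords_succ` — all BY NAME); THEOREMS + two housing `def`s (`CompD`, `SD`) + two layer `def`s; 0 `def … : Prop`, 0 cite, 0 sorry.

CONTENT.  §1 the seams on PART 1's datum — `sum_absD_head`, `envVar_D`, **`preBelowEnv_D`**, **`absorbLaw_D`** (EQUALITIES) — and housing at the
origin cubes (`CompD`∕`SD`).  §2 the ONE scalar set `(L, C, c̄, κ, N₀, A₀, m, s̄⁰, ρ′) = (21, 1, 0, 0, 3, 2, 1∕504, 1∕2, 41∕42)` (W8's `hloc21`; (w6)
`(1∕504)·(3·2·42) = 1∕2`; fan-out `(1∕504)·(1·3)·42 = 1∕4`; `absorbAmplitude = 4∕3 ≤ 2`); at the cell's integer `(Lb:ℝ) = 21` (HYPOTHESIS `hLb`, as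
in S3i ∕ S5e's faces) `leavesD hLb K` by `bookingLeavesCell` with `hS`∕`hcount` FROM `count_of_anchoring_cell` and **`hbirth` FROM
`hbirth_of_rstep_cell`**; `dressedStability_towerD` ∕ With-form ∕ ROOT-B through END-B at every cutoff; the literal instance `towerD 21`.  §3
GENUINE at the cutoffs `K + 2` (layers at `0 < 1 < 2`): `feltD_headCube_two` (the head's cube feels EVERY family — `coarsen_coords_sq`, W14
`coarsen_coords_succ`), `absD_head_two` (BOTH full layers absorbed), **`absorbed_count_depth_one = Lb⁴`**, **`absorbed_count_depth_two = (Lb⁴)²`**,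
the sharp multiplicity `hmultD_sharp` (`mB = 1`), **`count_attained_depth_one`∕`_two`**: row S5e's `count_absorbs_of_anchoring` ON THIS DATUM bounds
those cards by `(1·1)·(Lb⁴)^(2−1)` ∕ `(1·1)·(Lb⁴)^(2−0)` — EQUALITY both times (the exponent `j_b − j₀ = 2` binds); `live_count_attained`; `massD_two
= layerOne + layerTwo`, `absorbLaw_head_eq`, **`second_layer_charged`**, **`layer_ratio`** (`layerTwo = (Lb⁴·ρ·τ)·layerOne`) and **`located_product`**
(at `(Lb:ℝ) = 21`: `Lb⁴·ρ·τ = locCell 21 1 0 0 = e³∕21` — each further absorbed scale costs the previous one times `Λρ₁τ ≤ ρ′`: S5's geometric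
majorant `(1 − ρ′)⁻¹` IS the sum over absorbed depths, here with two live terms), `layers_le_majorant`.  Planted mutants (NOT filed; rc 1): the
depth-two count claimed `= Lb⁴` (`absorbed_count_depth_two`), `second_layer_charged` without `0 < Lb`, `located_product` without the `τ` step.

HONEST FRAMING (c4; offered wording).  «A DECIDED TOY at booking level: S5e's absorbed count and S4's live count reach `Λ^Δ` with equality at
`Δ = 1` AND `Δ = 2` on one ℝ-step datum, END-B fires with ONE K-free scalar set at the cell's integer `L = 21`, the second absorbed layer is
charged and costs layer one times `Λρ₁τ = e³∕21` — SOCKET COMPOSITION and TIGHTNESS of the crew's own count bookkeeping across TWO scales, NOT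
that components ∕ ℝ-operations ∕ D-terms of [Balaban1989LargeFieldII] were constructed or bounded; the function-level faces (S3u ∕ S3v) are NOT
exercised; `21` is the toy's integer = the least the located largeness admits (W8 `twenty_blocks_excluded`), never «Bałaban's L» (k2).»
[decided toy] ∕ [folklore]; 0 `def … : Prop`; 0 citations (the bracketed paper name is the rider's wording, no locus used).  0 binders
instantiated on Bałaban's densities; no wall item; the NE1′ wall wording of record v1.8 (T4-DAG v48 deb37c21e2d251d1) — words, not kind — does
NOT move; R-t4r2-Q2 NOT met; NE1′ ⇐ the named binders — NOT proved, NOT printed; spine PROVED 0∕9; count 9 unchanged.  Rung (B)+1 on ONE finite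
four-torus — NOT infinite volume, NOT a mass gap, NOT OS on ℝ⁴, NOT Clay.  HONEST DEPENDENCY: continuum YM on T⁴ ⇐ BetaPertH ∧ nine spine
estimates (0/9 proved); BetaPertH ⇐ (D1) ∧ (D4) ∧ CAP+tail; G-an2-4 gates asym, D1 and NE2/3/4.
-/

noncomputable section

namespace Summit.QuantumFields.BalabanUV.T4Continuum.NE1p.DressedSuppliedDepthTwoWitness

open Finset
open scoped BigOperators
open Literature.MathematicalPhysics.QuantumFieldTheory.Balaban1983to89
open Literature.MathematicalPhysics.QuantumFieldTheory.Balaban1983to89.T4TermFormat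
open Literature.MathematicalPhysics.QuantumFieldTheory.Balaban1983to89.T4TermFormat.Booking
open Literature.MathematicalPhysics.QuantumFieldTheory.Balaban1983to89.T4FeltGeometry
open Literature.MathematicalPhysics.QuantumFieldTheory.Balaban1983to89.T4TrajectoryComparison
open Literature.MathematicalPhysics.QuantumFieldTheory.Balaban1983to89.T4PreservedUnderR (RStep)
open Summit.QuantumFields.BalabanUV.T4Continuum.T4TrajectoryDensityDressed
open Summit.QuantumFields.BalabanUV.T4Continuum.NE1p.DressedRoot
open Summit.QuantumFields.BalabanUV.T4Continuum.NE1p.DressedUniformConstants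
open Summit.QuantumFields.BalabanUV.T4Continuum.NE1p.DressedAbsorptionWindow
open Summit.QuantumFields.BalabanUV.T4Continuum.NE1p.DressedPositionalCount
open Summit.QuantumFields.BalabanUV.T4Continuum.NE1p.DressedStabilityOfSuppliedSchedules
open Summit.QuantumFields.BalabanUV.T4Continuum.NE1p.DressedBirthRStepAnchored
open Summit.QuantumFields.BalabanUV.T4Continuum.NE1p.DressedSuppliedWitness (rW tW rW_pos tW_pos hL21 hloc21 hρ'21 stepProd_rW)
open Summit.QuantumFields.BalabanUV.T4Continuum.NE1p.DressedTowerWitnessBlocks (Blk coords coarsen_coords_succ)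

/-! ## §1 The seams with EQUALITY on PART 1's datum; housing at the origin cubes -/

section Seams
variable (Lb : ℕ)

/-- **THE HEAD PAYS FOR WHAT IT ABSORBS** [decided toy]: the absorbed pre-ℝ sizes at the head's birth scale sum to `massD`. [folklore] -/
theorem sum_absD_head (K : ℕ) : ∑ b₀ ∈ absD K (headD Lb), sizeD K b₀ (min 2 K) = massD Lb K := by
  refine sum_congr rfl fun b₀ hb₀ => ?_
  have hne : b₀ ≠ headD Lb := fun h => by have hlt := absD_lt K (headD Lb) b₀ hb₀; rw [h] at hlt; exact lt_irrefl _ hlt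
  unfold sizeD; rw [gD_of_ne K b₀ hne]

/-- The transported envelope of a toy family: `envVar 1 ρ b k = ρ^(k−j_b)·g b` (`k ≥ j_b`). [arith] [folklore] -/
theorem envVar_D (K : ℕ) (b : IxB Lb) {k : ℕ} (hk : scB K b ≤ k) :
    (TrD Lb K).envVar 1 (fun _ : ℕ => ((21 : ℝ) ^ 2)⁻¹ * alphaCell 0) b k = rW ^ (k - scB K b) * gD K b := by
  show ∑ k' ∈ Icc (scB K b) k, (1 : ℝ) * stepProd (fun _ : ℕ => ((21 : ℝ) ^ 2)⁻¹ * alphaCell 0) k' k *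
      (if k' = scB K b then gD K b else 0) = rW ^ (k - scB K b) * gD K b
  have hterm : ∀ k' ∈ Icc (scB K b) k, (1 : ℝ) * stepProd (fun _ : ℕ => ((21 : ℝ) ^ 2)⁻¹ * alphaCell 0) k' k *
      (if k' = scB K b then gD K b else 0) = if k' = scB K b then rW ^ (k - scB K b) * gD K b else 0 := by
    intro k' _
    split_ifs with h; · subst h; rw [stepProd_rW, one_mul]
    rw [mul_zero]
  rw [sum_congr rfl hterm, sum_ite_eq' (Icc (scB K b) k) (scB K b), if_pos (mem_Icc.mpr ⟨le_rfl, hk⟩)]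

/-- **`PreBelowEnv` HOLDS (with equality)** [decided toy]. [folklore] -/
theorem preBelowEnv_D (K : ℕ) (Gate : ℕ → Prop) :
    (TrD Lb K).PreBelowEnv (RsD Lb K) 1 (fun _ : ℕ => ((21 : ℝ) ^ 2)⁻¹ * alphaCell 0) Gate := by
  intro b k hbk _ _
  have hbk' : scB K b ≤ k := hbk
  show gD K b * rW ^ (k + 1 - scB K b) ≤ (((21 : ℝ) ^ 2)⁻¹ * alphaCell 0) *
    (TrD Lb K).envVar 1 (fun _ : ℕ => ((21 : ℝ) ^ 2)⁻¹ * alphaCell 0) b k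
  rw [envVar_D Lb K b hbk', Nat.sub_add_comm hbk', pow_succ]
  exact le_of_eq (by ring)

/-- **`AbsorbLaw` HOLDS — WITH EQUALITY AT THE HEAD, BOTH LAYERS SUMMED** [decided toy]; every other family is booked at its dressing. [folklore] -/
theorem absorbLaw_D (K : ℕ) : (TrD Lb K).AbsorbLaw (RsD Lb K) 1 (fun j => tW ^ (K - j)) AD := by
  intro b
  show (1 : ℝ) * (if scB K b = scB K b then gD K b else 0) ≤ tW ^ (K - scB K b) + AD * ∑ b₀ ∈ absD K b, sizeD K b₀ (scB K b)
  rw [if_pos rfl, one_mul]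
  by_cases h : b = headD Lb
  · subst h
    rw [show scB K (headD Lb) = min 2 K from rfl, sum_absD_head]
    exact le_of_eq rfl
  · rw [absD_of_ne K b h, sum_empty, mul_zero, add_zero, gD_of_ne K b h]

/-- MET COMPONENTS [decided toy]: the origin cube of the current scale; nothing above the cutoff. [folklore] -/
def CompD (K : ℕ) (k : ℕ) (_b : IxB Lb) : Finset (IxC Lb K) :=
  if h : k ≤ K then {Sum.inr (Sum.inr ⟨k, Nat.lt_succ_of_le h⟩)} else ∅

/-- LIVE FAMILIES of a met component [decided toy]: what its cube feels. [folklore] -/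
def SD (K : ℕ) (k : ℕ) (b : IxB Lb) : Finset (IxB Lb) := (CompD Lb K k b).biUnion (feltD K)

/-- [folklore] The components' cubes have the current scale. -/
theorem hscaleD (K : ℕ) : ∀ k b, ∀ q ∈ CompD Lb K k b, (BkD Lb K).cubeScale q = k := by
  intro k b q hq
  show scC K q = k
  unfold CompD at hq
  split_ifs at hq with h
  · have hq' : q = Sum.inr (Sum.inr ⟨k, Nat.lt_succ_of_le h⟩) := mem_singleton.mp hq; subst hq'; rfl
  · simp at hq

/-- [folklore] Live families are housed (by construction: they are what the component's cube feels). -/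
theorem hhousedD (K : ℕ) : ∀ k b, ∀ f ∈ SD Lb K k b, ∃ q ∈ CompD Lb K k b, f ∈ (BkD Lb K).feltAt q :=
  fun k b f hf => by obtain ⟨q, hq, hfq⟩ := mem_biUnion.mp hf; exact ⟨q, hq, hfq⟩

/-- [folklore] Component volume `v = 1`. -/
theorem hvolD (K : ℕ) : ∀ k b, (CompD Lb K k b).card ≤ 1 := by
  intro k b; unfold CompD; split_ifs <;> simp

end Seams

/-! ## §2 The ONE scalar set, the leaves through the suppliers, and the root through END-B at the cell's integer `(Lb:ℝ) = 21` -/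

section Root

/-- (w6) window: `m·(N₀A₀(1−ρ′)⁻¹) = (1∕504)·(3·2·42) = 1∕2 ≤ 1 − s̄⁰`. [folklore] -/
theorem hsmallD : (1 / 504 : ℝ) * (3 * 2 * (1 - 41 / 42)⁻¹) ≤ 1 - 1 / 2 := by norm_num

/-- `v·mB = 1·3 ≤ N₀ = 3`. [folklore] -/ theorem hvN₀D : (((1 : ℕ) : ℝ)) * ((3 : ℕ) : ℝ) ≤ 3 := by norm_num
/-- `mB = 3 ≤ N₀ = 3`. [folklore] -/ theorem hmN₀D : (((3 : ℕ) : ℝ)) ≤ 3 := by norm_num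
/-- Fan-out of the absorbed multiplicity `vR·mB = 3` below one: `(1∕504)·3·42 = 1∕4`. [folklore] -/
theorem hfanD : fanout AD (((1 : ℕ) : ℝ) * ((3 : ℕ) : ℝ)) (41 / 42) < 1 := by norm_num [fanout]

/-- The absorption fixed point is inside the class amplitude: `absorbAmplitude 1 (1∕504) 3 (41∕42) = 4∕3 ≤ 2 = A₀`. [folklore] -/
theorem hampD : absorbAmplitude 1 AD (((1 : ℕ) : ℝ) * ((3 : ℕ) : ℝ)) (41 / 42) ≤ 2 := by norm_num [absorbAmplitude, fanout]

variable {Lb : ℕ}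

/-- **TOY LEAVES AT THE CELL — `hS`∕`hcount` BY `count_of_anchoring_cell`, `hbirth` BY `hbirth_of_rstep_cell`** [decided toy]: at every cutoff the
leaf bundle over `uniformConstantsCell 21 1 0 0 3 2 (1∕504) (1∕2) (41∕42)`; the birth leaf off the ℝ-step datum whose head absorbs BOTH older layers;
transport with equality, no regeneration; the anchoring's blocking integer is the cell's, `(Lb:ℝ) = 21` (hypothesis, as in S3i ∕ S5e). [folklore] -/
def leavesD (hLb : (Lb : ℝ) = 21) (K : ℕ) :
    BookingLeaves (uniformConstantsCell 21 1 0 0 3 2 (1 / 504) (1 / 2) (41 / 42) hL21 zero_le_one le_rfl le_rfl (by norm_num)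
      (by norm_num) (by norm_num) hloc21 hρ'21 hsmallD) (BkD Lb K) (TrD Lb K) :=
  bookingLeavesCell hL21 zero_le_one le_rfl le_rfl (by norm_num) (by norm_num) (by norm_num) hloc21 hρ'21 hsmallD
    (fun _ => 0) (fun _ _ => 0) (SD Lb K) (fun _ => le_rfl) (fun _ _ => le_rfl)
    (count_of_anchoring_cell (AncD Lb K) hLb hL21 (hmultD Lb K) (hscaleD Lb K) (hhousedD Lb K) (hvolD Lb K) hvN₀D).1
    (count_of_anchoring_cell (AncD Lb K) hLb hL21 (hmultD Lb K) (hscaleD Lb K) (hhousedD Lb K) (hvolD Lb K) hvN₀D).2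
    (fun _ _ => by norm_num)
    (hbirth_of_rstep_cell hL21 zero_le_one le_rfl le_rfl (by norm_num) (by norm_num) (by norm_num) hloc21 hρ'21 hsmallD
      (TrD Lb K) (RsD Lb K) (fun _ : ℕ => ((21 : ℝ) ^ 2)⁻¹ * alphaCell 0) (fun _ _ => 0) (SD Lb K) (AncD Lb K)
      hLb (hmultD Lb K) (compVolD Lb K) (by norm_num) (preBelowEnv_D Lb K _) (absorbLaw_D Lb K)
      (fun j _ => by rw [one_mul]; exact le_rfl) hfanD hampD)
    (fun b k' k _ _ _ _ => by
      show (if k' = scB K b then sizeD K b k else 0) ≤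
        1 * stepProd (fun _ : ℕ => ((21 : ℝ) ^ 2)⁻¹ * alphaCell 0) k' k * (if k' = scB K b then gD K b else 0)
      by_cases h : k' = scB K b
      · subst h; rw [if_pos rfl, if_pos rfl, stepProd_rW, one_mul]; exact le_of_eq (mul_comm _ _)
      · rw [if_neg h, if_neg h]; simp)
    (fun b k hbk _ _ => by
      have hbk' : scB K b ≤ k := hbk
      show (if k + 1 = scB K b then gD K b else 0) ≤ 0 * sizeD K b k
      rw [if_neg (by omega), zero_mul])

/-- **END-B FIRES ON THE DEPTH-TWO DATUM** [decided toy]: `dressedStability_of_cell` with the ONE cell at every cutoff, leaves by `leavesD`. [folklore] -/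
theorem dressedStability_towerD (hLb : (Lb : ℝ) = 21) : DressedStability (towerD Lb) :=
  dressedStability_of_cell (towerD Lb) hL21 zero_le_one le_rfl le_rfl (by norm_num) (by norm_num) (by norm_num) hloc21 hρ'21
    hsmallD fun _ K => leavesD hLb K

/-- … with the constants displayed: class amplitude `2`, family factor `rhoOne 21⁻² 1 0 0`, source decay `21⁻³`. [folklore] -/
theorem dressedStabilityWith_towerD (hLb : (Lb : ℝ) = 21) :
    DressedStabilityWith (towerD Lb) 2 (rhoOne ((21 : ℝ) ^ 2)⁻¹ 1 0 0) ((21 : ℝ)⁻¹ ^ 3) :=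
  dressedStabilityWith_of_bookingLeaves _ (towerD Lb) fun _ K => leavesD hLb K

/-- **ROOT-B ON THE DEPTH-TWO DATUM** [decided toy]: unit weights, counts `3·(21⁴)^(k−j)` by `positionalCount_of_anchoring_cell`. [folklore] -/
theorem dressedBudget_towerD (hLb : (Lb : ℝ) = 21) : DressedBudget (towerD Lb) (fun _ _ _ => 1) :=
  dressedBudget_of_dressedStabilityWith_strict (Λ := (21 : ℝ) ^ 4) (N₀ := 3) (r := 41 / 42) (wbar := 1)
    (dressedStabilityWith_towerD hLb) (by norm_num) (by norm_num) (by rw [prod_cell (by norm_num)]; exact hloc21) hρ'21 zero_le_one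
    (fun _ _ _ _ => zero_le_one) (fun _ _ _ _ => le_rfl)
    fun _ K => positionalCount_of_anchoring_cell (AncD Lb K) hLb hL21 (hmultD Lb K) hmN₀D

/-- THE LITERAL INSTANCE [decided toy]: at `Lb = 21` the tower — sub-blocks `Fin 4 → Fin 441`, blocks `Fin 4 → Fin 21` — is dressed-stable. -/
theorem dressedStability_towerD_twentyOne : DressedStability (towerD 21) := dressedStability_towerD (by norm_num)

end Root

/-! ## §3 GENUINE: from cutoff `2` on the head absorbs BOTH full layers — S5e's count ATTAINED at depths 1 AND 2; the second layer charged -/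

section Genuine
variable (Lb : ℕ)

/-- [folklore] At the cutoffs `K + 2` the head sits at scale `2`. -/
theorem scB_head (K : ℕ) : scB (K + 2) (headD Lb) = 2 := by simp [scB]

variable {Lb} in
/-- [folklore] Two or more `Lb`-fold blockings send every sub-block of `[0, Lb·Lb)⁴` to the block `0` (`x i < Lb·Lb = Lb² ≤ Lb^(n+2)`; beside
W14's `coarsen_coords_succ`). -/
theorem coarsen_coords_sq (x : Blk (Lb * Lb)) (n : ℕ) : coarsen Lb (n + 2) (coords x) = 0 := by
  funext i
  simp only [coarsen, coords, Pi.zero_apply]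
  have hx := (x i).isLt
  have hLb : 1 ≤ Lb := Nat.pos_of_ne_zero fun h => by subst h; exact absurd hx (by simp)
  refine Nat.div_eq_of_lt (hx.trans_le ?_)
  calc Lb * Lb = Lb ^ 2 := (sq Lb).symm
    _ ≤ Lb ^ (n + 2) := Nat.pow_le_pow_right hLb (by omega)

/-- **FROM CUTOFF `2` ON, THE HEAD's ORIGIN CUBE FEELS EVERY FAMILY** [decided toy]: every sub-block's key coarsens to `0` in two steps
(`coarsen_coords_sq`), every block's in one (W14 `coarsen_coords_succ`), the head's in none. [folklore] -/
theorem feltD_headCube_two (K : ℕ) : feltD (K + 2) (headCube (K + 2) : IxC Lb (K + 2)) = univ := by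
  ext b
  simp only [mem_univ, iff_true, mem_feltD_origin]
  have hmin : min 2 (K + 2) = 2 := Nat.min_eq_left (by omega)
  rcases b with x | y | u
  · refine ⟨Nat.zero_le _, ?_⟩
    show coarsen Lb (min 2 (K + 2) - 0) (coords x) = 0
    rw [hmin]; exact coarsen_coords_sq x 0
  · refine ⟨by show min 1 (K + 2) ≤ min 2 (K + 2); omega, ?_⟩
    show coarsen Lb (min 2 (K + 2) - min 1 (K + 2)) (coords y) = 0
    rw [hmin, Nat.min_eq_left (by omega : 1 ≤ K + 2)]; exact coarsen_coords_succ y 0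
  · exact ⟨le_rfl, by funext j; simp [coarsen, keyD]⟩

/-- **FROM CUTOFF `2` ON, THE HEAD ABSORBS BOTH FULL LAYERS** [decided toy]: `absorbs head = {b : scale b < 2}` = all sub-blocks and all
blocks. [folklore] -/
theorem absD_head_two (K : ℕ) : absD (K + 2) (headD Lb) = univ.filter fun b => scB (K + 2) b < 2 := by
  show (feltD (K + 2) (headCube (K + 2) : IxC Lb (K + 2))).filter (fun b => scB (K + 2) b < min 2 (K + 2)) = _
  rw [feltD_headCube_two, Nat.min_eq_left (by omega : 2 ≤ K + 2)]

/-- [folklore] The absorbed families of scale `1` are exactly the blocks … -/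
theorem absD_head_filter_one (K : ℕ) :
    ((absD (K + 2) (headD Lb)).filter fun b₀ => scB (K + 2) b₀ = 1) = (univ : Finset (Blk Lb)).map blkEmb := by
  ext b; rw [absD_head_two, filter_filter]; rcases b with x | y | u <;> simp [scB, blkEmb]

/-- [folklore] … and those of scale `0` exactly the sub-blocks. -/
theorem absD_head_filter_zero (K : ℕ) :
    ((absD (K + 2) (headD Lb)).filter fun b₀ => scB (K + 2) b₀ = 0) = (univ : Finset (Blk (Lb * Lb))).map subEmb := by
  ext b; rw [absD_head_two, filter_filter]; rcases b with x | y | u <;> simp [scB, subEmb]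

/-- [folklore] `n⁴` blocks of side `n`. -/
theorem card_Blk (n : ℕ) : Fintype.card (Blk n) = n ^ 4 := by simp [Blk, Fintype.card_fin]

/-- **THE ABSORBED COUNT AT DEPTH ONE** [decided toy]: from cutoff `2` on the head absorbs `Lb⁴` families ONE scale down. [folklore] -/
theorem absorbed_count_depth_one (K : ℕ) :
    (((RsD Lb (K + 2)).absorbs (headD Lb)).filter fun b₀ => (BkD Lb (K + 2)).birthScale b₀ = 1).card = Lb ^ 4 := by
  show ((absD (K + 2) (headD Lb)).filter fun b₀ => scB (K + 2) b₀ = 1).card = Lb ^ 4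
  rw [absD_head_filter_one, card_map, card_univ, card_Blk]

/-- **THE ABSORBED COUNT AT DEPTH TWO** [decided toy]: from cutoff `2` on the head absorbs `(Lb·Lb)⁴ = (Lb⁴)²` families TWO scales down.
[folklore] -/
theorem absorbed_count_depth_two (K : ℕ) :
    (((RsD Lb (K + 2)).absorbs (headD Lb)).filter fun b₀ => (BkD Lb (K + 2)).birthScale b₀ = 0).card = (Lb ^ 4) ^ 2 := by
  show ((absD (K + 2) (headD Lb)).filter fun b₀ => scB (K + 2) b₀ = 0).card = (Lb ^ 4) ^ 2
  rw [absD_head_filter_zero, card_map, card_univ, card_Blk]; ring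

variable {Lb} in
/-- [folklore] From cutoff `2` on the three layers sit at three scales: equal scales force equal layers. -/
theorem layer_eq_of_scB_eq (K : ℕ) : ∀ a b : IxB Lb, scB (K + 2) a = scB (K + 2) b → layer a = layer b := by
  rintro (_ | _ | _) (_ | _ | _) h <;> simp [scB, layer] at h ⊢

/-- **THE SHARP MULTIPLICITY `mB = 1` FROM CUTOFF `2` ON** [decided toy]: one family per scale per block. [folklore] -/
theorem hmultD_sharp (K : ℕ) : ∀ j (x : Fin 4 → ℕ),
    ((BkD Lb (K + 2)).births.filter fun b => (BkD Lb (K + 2)).birthScale b = j ∧ x ∈ (AncD Lb (K + 2)).dom b).card ≤ 1 := by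
  intro j x
  show ((univ : Finset (IxB Lb)).filter fun b => scB (K + 2) b = j ∧ x ∈ ({keyD b} : Finset (Fin 4 → ℕ))).card ≤ 1
  refine card_le_one.mpr fun a ha b hb => ?_
  have ha' := (mem_filter.mp ha).2
  have hb' := (mem_filter.mp hb).2
  rw [mem_singleton] at ha' hb'
  exact keyD_inj a b (layer_eq_of_scB_eq K a b (ha'.1.trans hb'.1.symm)) (ha'.2.symm.trans hb'.2)

variable {Lb}

/-- **S5e's BOUND IS ATTAINED AT DEPTH ONE** [decided toy]: row S5e's `count_absorbs_of_anchoring` on THIS datum (`v = mB = 1`, blocking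
integer `Lb > 0`, `d = 4`) bounds the head's scale-`1` absorbed count by `(1·1)·(Lb⁴)^(2−1)` — and the count EQUALS it. [folklore] -/
theorem count_attained_depth_one (hLb0 : 0 < Lb) (K : ℕ) :
    ((((RsD Lb (K + 2)).absorbs (headD Lb)).filter fun b₀ => (BkD Lb (K + 2)).birthScale b₀ = 1).card : ℝ) ≤
        (((1 : ℕ) : ℝ) * ((1 : ℕ) : ℝ)) * (((Lb : ℕ) : ℝ) ^ 4) ^ ((BkD Lb (K + 2)).birthScale (headD Lb) - 1) ∧
      ((((RsD Lb (K + 2)).absorbs (headD Lb)).filter fun b₀ => (BkD Lb (K + 2)).birthScale b₀ = 1).card : ℝ) =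
        (((1 : ℕ) : ℝ) * ((1 : ℕ) : ℝ)) * (((Lb : ℕ) : ℝ) ^ 4) ^ ((BkD Lb (K + 2)).birthScale (headD Lb) - 1) :=
  ⟨count_absorbs_of_anchoring (RsD Lb (K + 2)) (AncD Lb (K + 2)) hLb0 (hmultD_sharp Lb K) (compVolD Lb (K + 2)) (headD Lb) 1, by
    rw [absorbed_count_depth_one, show (BkD Lb (K + 2)).birthScale (headD Lb) = scB (K + 2) (headD Lb) from rfl, scB_head]
    push_cast; ring⟩

/-- **S5e's BOUND IS ATTAINED AT DEPTH TWO** [decided toy]: the same bound at `j₀ = 0` reads `(1·1)·(Lb⁴)^(2−0)` — and the head's scale-`0`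
absorbed count EQUALS it: the exponent `j_b − j₀ = 2` of the positional rate binds. [folklore] -/
theorem count_attained_depth_two (hLb0 : 0 < Lb) (K : ℕ) :
    ((((RsD Lb (K + 2)).absorbs (headD Lb)).filter fun b₀ => (BkD Lb (K + 2)).birthScale b₀ = 0).card : ℝ) ≤
        (((1 : ℕ) : ℝ) * ((1 : ℕ) : ℝ)) * (((Lb : ℕ) : ℝ) ^ 4) ^ ((BkD Lb (K + 2)).birthScale (headD Lb) - 0) ∧
      ((((RsD Lb (K + 2)).absorbs (headD Lb)).filter fun b₀ => (BkD Lb (K + 2)).birthScale b₀ = 0).card : ℝ) =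
        (((1 : ℕ) : ℝ) * ((1 : ℕ) : ℝ)) * (((Lb : ℕ) : ℝ) ^ 4) ^ ((BkD Lb (K + 2)).birthScale (headD Lb) - 0) :=
  ⟨count_absorbs_of_anchoring (RsD Lb (K + 2)) (AncD Lb (K + 2)) hLb0 (hmultD_sharp Lb K) (compVolD Lb (K + 2)) (headD Lb) 0, by
    rw [absorbed_count_depth_two, show (BkD Lb (K + 2)).birthScale (headD Lb) = scB (K + 2) (headD Lb) from rfl, scB_head]
    push_cast; ring⟩

/-- **THE LIVE COUNT AT THE HEAD's CUBE IS ATTAINED AT DEPTH TWO TOO** [decided toy]: the head's origin cube feels `(Lb⁴)²` families of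
scale `0` — row S4's positional count `1·(Lb⁴)^(k−j)` (`positionalCount_of_anchoring`, sharp multiplicity) holds, with equality at `(j, k) = (0, 2)`.
[folklore] -/
theorem live_count_attained (hLb0 : 0 < Lb) (K : ℕ) :
    ((BkD Lb (K + 2)).feltOfScale (headCube (K + 2)) 0).card = (Lb ^ 4) ^ 2 ∧
      (BkD Lb (K + 2)).PositionalCount fun j k => ((1 : ℕ) : ℝ) * (((Lb : ℕ) : ℝ) ^ 4) ^ (k - j) := by
  refine ⟨?_, (AncD Lb (K + 2)).positionalCount_of_anchoring hLb0 (hmultD_sharp Lb K)⟩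
  show ((feltD (K + 2) (headCube (K + 2) : IxC Lb (K + 2))).filter fun b => scB (K + 2) b = 0).card = (Lb ^ 4) ^ 2
  have h : ((feltD (K + 2) (headCube (K + 2) : IxC Lb (K + 2))).filter fun b => scB (K + 2) b = 0) =
      (univ : Finset (Blk (Lb * Lb))).map subEmb := by
    rw [feltD_headCube_two]; ext b; rcases b with x | y | u <;> simp [scB, subEmb]
  rw [h, card_map, card_univ, card_Blk]; ring

variable (Lb)

/-- ABSORBED LAYER ONE at cutoff `K + 2` [decided toy]: `Lb⁴` blocks × their pre-ℝ size `τ^(K+1)·ρ` at the head's birth scale. [folklore] -/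
def layerOne (K : ℕ) : ℝ := (Lb : ℝ) ^ 4 * (tW ^ (K + 1) * rW)

/-- SECOND ABSORBED LAYER [decided toy]: `(Lb·Lb)⁴` sub-blocks × their pre-ℝ size `τ^(K+2)·ρ²`. [folklore] -/
def layerTwo (K : ℕ) : ℝ := ((Lb : ℝ) * Lb) ^ 4 * (tW ^ (K + 2) * rW ^ 2)

/-- **THE ABSORBED MASS IS THE TWO LAYERS** [decided toy]: from cutoff `2` on, `massD Lb (K+2) = layerOne + layerTwo` (the sum over the
absorbed set split by layer, cardinalities by `Fintype.card_fun`). [folklore] -/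
theorem massD_two (K : ℕ) : massD Lb (K + 2) = layerOne Lb K + layerTwo Lb K := by
  unfold massD
  rw [absD_head_two, sum_filter, Fintype.sum_sum_type, Fintype.sum_sum_type]
  simp only [scB, Nat.min_eq_left (by omega : 1 ≤ K + 2), Nat.min_eq_left (by omega : 2 ≤ K + 2), Nat.zero_lt_two,
    Nat.one_lt_two, lt_irrefl, if_true, if_false, sum_const, card_univ, card_Blk, Fintype.card_unit, Nat.sub_zero,
    show K + 2 - 1 = K + 1 by omega, show (2 : ℕ) - 1 = 1 from rfl, pow_one]
  unfold layerOne layerTwo; ring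

/-- [folklore] Both layers are positive for a genuine blocking integer `Lb > 0`. -/
theorem layers_pos (hLb0 : 0 < Lb) (K : ℕ) : 0 < layerOne Lb K ∧ 0 < layerTwo Lb K := by
  have h0 : (0 : ℝ) < Lb := by exact_mod_cast hLb0
  unfold layerOne layerTwo; have := rW_pos; have := tW_pos; exact ⟨by positivity, by positivity⟩

/-- **THE ABSORPTION LAW WITH EQUALITY AT THE HEAD** [decided toy]: from cutoff `2` on, birth generation = dressing `τ^K` `+ AD ×` (layer one +
layer two). [folklore] -/
theorem absorbLaw_head_eq (K : ℕ) :
    (TrD Lb (K + 2)).gen (headD Lb) 2 = (RsD Lb (K + 2)).δ (headD Lb) + AD * (layerOne Lb K + layerTwo Lb K) := by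
  show (if (2 : ℕ) = scB (K + 2) (headD Lb) then gD (K + 2) (headD Lb) else 0) =
    tW ^ (K + 2 - scB (K + 2) (headD Lb)) + AD * (layerOne Lb K + layerTwo Lb K)
  rw [scB_head, if_pos rfl, ← massD_two]
  show tW ^ (K + 2 - min 2 (K + 2)) + AD * massD Lb (K + 2) = tW ^ (K + 2 - 2) + AD * massD Lb (K + 2)
  rw [Nat.min_eq_left (by omega : 2 ≤ K + 2)]

/-- **THE SECOND LAYER IS CHARGED** [decided toy]: for `Lb > 0` the head's birth generation STRICTLY exceeds its dressing plus `AD ×` layer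
one — the families two scales down are really paid for. [folklore] -/
theorem second_layer_charged (hLb0 : 0 < Lb) (K : ℕ) :
    (RsD Lb (K + 2)).δ (headD Lb) + AD * layerOne Lb K < (TrD Lb (K + 2)).gen (headD Lb) 2 := by
  rw [absorbLaw_head_eq, mul_add]
  have := (layers_pos Lb hLb0 K).2
  have hA : (0 : ℝ) < AD := by norm_num
  nlinarith

/-- **THE LAYER RATIO** [decided toy]: layer two costs layer one times `Lb⁴·ρ·τ` — `Lb⁴` times as many families, each one transport
step (`ρ`) and one dressing step (`τ`) cheaper. [folklore] -/
theorem layer_ratio (K : ℕ) : layerTwo Lb K = ((Lb : ℝ) ^ 4 * rW * tW) * layerOne Lb K := by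
  unfold layerOne layerTwo; ring

variable {Lb}

/-- **… AND AT THE CELL's INTEGER THAT FACTOR IS THE LOCATED PRODUCT** [decided toy]: for `(Lb:ℝ) = 21`, `Lb⁴·ρ·τ = locCell 21 1 0 0`
(`= Λ·ρ₁·τ = e³∕21` at `κ = c̄ = 0`, row S3's `prod_cell`) — each further absorbed scale costs the previous one times `Λρ₁τ ≤ ρ′`: row S5's
geometric majorant `(1 − ρ′)⁻¹` is the sum over absorbed depths, read on a datum where two of its terms are live. [folklore] -/
theorem located_product (hLb : (Lb : ℝ) = 21) : (Lb : ℝ) ^ 4 * rW * tW = locCell 21 1 0 0 := by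
  rw [hLb]
  show (21 : ℝ) ^ 4 * (((21 : ℝ) ^ 2)⁻¹ * alphaCell 0) * ((21 : ℝ)⁻¹ ^ 3) = locCell 21 1 0 0
  unfold locCell; field_simp; ring

/-- **THE TWO LAYERS AGAINST S5's MAJORANT** [decided toy]: at the cell's integer the charged mass `layerOne + layerTwo = layerOne·(1 + Λρ₁τ)`
sits below the geometric majorant `layerOne·(1 − ρ′)⁻¹` the supplier charges at `ρ′ = 41∕42` (`Λρ₁τ = e³∕21 ≤ 41∕42`, W8 `hloc21`). [folklore] -/
theorem layers_le_majorant (hLb : (Lb : ℝ) = 21) (K : ℕ) :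
    layerOne Lb K + layerTwo Lb K ≤ layerOne Lb K * (1 - 41 / 42)⁻¹ := by
  rw [layer_ratio, located_product hLb]
  have hLb0 : 0 < Lb := by
    have h : (0 : ℝ) < (Lb : ℝ) := by rw [hLb]; norm_num
    exact_mod_cast h
  have h1 := (layers_pos Lb hLb0 K).1
  have hloc := hloc21
  nlinarith

/-- Decided instance (blocking integer `2`, cutoff `2`): the head absorbs `(2⁴)² = 256` sub-blocks and `2⁴ = 16` blocks, and the second
layer is charged — on the SAME datum. -/
example : (((RsD 2 2).absorbs (headD 2)).filter fun b₀ => (BkD 2 2).birthScale b₀ = 0).card = (2 ^ 4) ^ 2 ∧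
    (((RsD 2 2).absorbs (headD 2)).filter fun b₀ => (BkD 2 2).birthScale b₀ = 1).card = 2 ^ 4 ∧
    (RsD 2 2).δ (headD 2) + AD * layerOne 2 0 < (TrD 2 2).gen (headD 2) 2 :=
  ⟨absorbed_count_depth_two 2 0, absorbed_count_depth_one 2 0, second_layer_charged 2 two_pos 0⟩

end Genuine

end Summit.QuantumFields.BalabanUV.T4Continuum.NE1p.DressedSuppliedDepthTwoWitness

end
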